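import Summits.ValiantsHypothesis.ValiantsHypothesis.Theorems.AnyonJetsJetConstantElimMultiplierRemovalPerEasy
import Summits.ValiantsHypothesis.ValiantsHypothesis.Theorems.AnyonJetsJetConstantElimDefs
import Mathlib.NumberTheory.Padics.PadicVal.Basic

/-!
# AnyonJets — crux `JetConstantElim` (stmt-ValiantsHypothesis-16737): the cheapest falsifier of
# the re-glued crux `CF^ult` — if `PER` is constant-free easy, the jets have cheap multiples of
# polynomial 2-ADIC DEPTH, so `CF^ult` fails

The multiplier bypass re-glues route `AnyonJets` on `CF^ult := ∀ c ∃ k ≥ 1, CFUltAt c k`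
(multiplier-robust constant-free jet growth, `AnyonJetsJetConstantElimDefs.lean`) and `CE^ult₂`.
For the tribunal of the re-glued route this file records WHAT KILLS `CF^ult`, in kernel form: the
multiplier `M = det V · 2^{p(n)}` of `AnyonJetsJetConstantElimMultiplierRemovalPerEasy.lean`
(`V` the integer Vandermonde matrix on `0, …, C(n,2)`, `p` from Bürgisser's Thm. 2.10) has
polynomial 2-adic valuation (`det V ≤ m^{m²}`, `v₂ ≤ log₂`; `p` is polynomially bounded), hence

* `cheapJetMultiple_explicit` — the explicit-multiplier form of `cheapJetMultiples_of_twoPowPencilCheap`;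
* `padicValNat_two_vandermondeMultiplier_le` — `v₂(det V · 2^{p}) ≤ m²(log₂ m + 1) + p`;
* `cheapJetMultiplesTwoAdic_of_perEasy` — `τ(PER_n) = n^{O(1)} ⟹ ∃ c ∀ n k ∃ M ≥ 1,
  v₂(M) ≤ (n+2)^c ∧ τ(M·J_(n,k)) ≤ (n+2)^c`;
* `not_cfUlt_of_perEasy` — `τ(PER_n) = n^{O(1)} ⟹ ¬CF^ult`, i.e. `cfUlt ⊢ τ(PER)` superpolynomial
  (`not_isPBounded_tau_per_of_cfUlt`): the re-glued constant-free crux is, like the Boolean far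
  side it comes from, at least as strong as "the permanent is not constant-free easy" — and it is
  refuted by nothing weaker that is known.

Honest framing: conditional calibration of an OPEN crux; VP ≠ VNP is NOT proved here.

References: P. Bürgisser, *On defining integers …*, Comput. Complexity 18 (2009), Thm. 2.10;
P. Koiran, S. Perifel, *Interpolation in Valiant's theory*, Comput. Complexity 20 (2011), Lemma 8–9.
-/

noncomputable section

-- single-conjunct layout: Sub = Summit, duplicated namespace component intended
set_option linter.dupNamespace false

namespace Summit.ValiantsHypothesis.ValiantsHypothesis.Theorems.AnyonJets.JetConstantElim

open MvPolynomial Literature.Computability.AlgebraicComplexity Finset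
open Summit.ValiantsHypothesis.ValiantsHypothesis.Theses.AnyonJets
open Summit.ValiantsHypothesis.ValiantsHypothesis.Theorems.AnyonJets.ConstantFreeJetGrowth (jet)
open Summit.ValiantsHypothesis.ValiantsHypothesis.Theorems.AnyonJets.UniformJet

/-! ### The explicit multiplier -/

/-- **Explicit-multiplier form** of `cheapJetMultiples_of_twoPowPencilCheap`: for `k ≤ C(n,2)`,
`τ((det V · 2^{p(n)})·J_(n,k)) ≤ (n+2)^{a+15}` where `V` is the integer Vandermonde matrix on the
`m = C(n,2)+1` nodes `0, …, C(n,2)` (same proof; the multiplier is now named). [folklore] -/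
theorem cheapJetMultiple_explicit (p : ℕ → ℕ) (a : ℕ)
    (hF : ∀ n : ℕ, constantFreeComplexity (C ((2 : ℤ) ^ p n) * ∑ σ : Equiv.Perm (Fin n),
        (X none : MvPolynomial (Option (Fin n × Fin n)) ℤ) ^
            (univ.filter (fun q : Fin n × Fin n => q.1 < q.2 ∧ σ q.2 < σ q.1)).card *
          ∏ i : Fin n, X (some (σ i, i))) ≤ n ^ a + a)
    (n k : ℕ) (hk : k < n * (n - 1) / 2 + 1) :
    constantFreeComplexity
        ((((Matrix.vandermonde (fun i : Fin (n * (n - 1) / 2 + 1) => (i : ℤ))).det.toNat *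
            2 ^ p n : ℕ) : ℤ) • jet n k) ≤ (n + 2) ^ (a + 15) := by
  -- the shifted pencil as a polynomial in `u`, its degree, and the jet as a coefficient
  set G := optionEquivLeft ℤ (Fin n × Fin n) (∑ σ : Equiv.Perm (Fin n),
      ((X none : MvPolynomial (Option (Fin n × Fin n)) ℤ) - 1) ^
          (univ.filter (fun q : Fin n × Fin n => q.1 < q.2 ∧ σ q.2 < σ q.1)).card *
        ∏ i : Fin n, X (some (σ i, i))) with hG
  set m := n * (n - 1) / 2 + 1 with hm
  have hdeg : G.natDegree < m := Nat.lt_succ_of_le (natDegree_shiftedPencil_le ℤ n)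
  have hjet : jet n k = (-1 : ℤ) ^ k • G.coeff k := by
    have h := map_jet_eq_smul_coeff ℤ n k
    rw [Int.castRingHom_int, MvPolynomial.map_id] at h
    exact h
  have hX2 : 2 ≤ n + 2 := by omega
  -- the Vandermonde multiplier
  set V := Matrix.vandermonde (fun i : Fin m => (i : ℤ)) with hV
  have hDpos : 0 < V.det := det_vandermonde_nat_pos m
  set κ : Fin m := ⟨k, hk⟩ with hκ
  -- the specialised multiples and the identity `M·J = Σ_i C(± adj_{k,i}) · (2^p P_n)(i-1; X)`
  set F := C ((2 : ℤ) ^ p n) * ∑ σ : Equiv.Perm (Fin n),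
      (X none : MvPolynomial (Option (Fin n × Fin n)) ℤ) ^
          (univ.filter (fun q : Fin n × Fin n => q.1 < q.2 ∧ σ q.2 < σ q.1)).card *
        ∏ i : Fin n, X (some (σ i, i)) with hFdef
  have hId : ((V.det.toNat * 2 ^ p n : ℕ) : ℤ) • jet n k =
      ∑ i : Fin m, C ((-1) ^ k * V.adjugate κ i) *
        aeval (fun o : Option (Fin n × Fin n) => o.elim (C ((i : ℤ) - 1)) X) F := by
    have hA := det_vandermonde_mul_coeff_eq_sum G hdeg κ
    have hcast : ((V.det.toNat * 2 ^ p n : ℕ) : ℤ) = 2 ^ p n * V.det := by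
      push_cast
      rw [Int.toNat_of_nonneg hDpos.le]
      ring
    have hterm : ∀ i : Fin m, C ((-1) ^ k * V.adjugate κ i) *
        aeval (fun o : Option (Fin n × Fin n) => o.elim (C ((i : ℤ) - 1)) X) F =
          C ((-1 : ℤ) ^ k * 2 ^ p n) * ((V.adjugate κ i : MvPolynomial (Fin n × Fin n) ℤ) *
            G.eval ((i : ℕ) : MvPolynomial (Fin n × Fin n) ℤ)) := by
      intro i
      rw [hFdef, aeval_elim_twoPowPencil, ← hG]
      have e1 : (C (i : ℤ) : MvPolynomial (Fin n × Fin n) ℤ) = ((i : ℕ) : MvPolynomial (Fin n × Fin n) ℤ) :=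
        map_natCast C i
      rw [e1]
      simp only [map_mul, eq_intCast]
      ring
    rw [Finset.sum_congr rfl fun i _ => hterm i, ← Finset.mul_sum, ← hA, hcast, hjet, smul_smul,
      MvPolynomial.smul_eq_C_mul]
    have hκk : ((κ : ℕ)) = k := rfl
    rw [hκk]
    simp only [map_mul, eq_intCast]
    ring
  rw [hId]
  -- cost of one term
  have hmX : m + 1 ≤ (n + 2) ^ 2 := nodes_le_sq n
  have hterm : ∀ i : Fin m, constantFreeComplexity (C ((-1) ^ k * V.adjugate κ i) *
      aeval (fun o : Option (Fin n × Fin n) => o.elim (C ((i : ℤ) - 1)) X) F) ≤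
        18 * (n + 2) ^ (a + 8) + 1 := by
    intro i
    refine (constantFreeComplexity_mul_le _ _).trans (Nat.add_le_add_right ?_ 1)
    have h1 : constantFreeComplexity (C ((-1) ^ k * V.adjugate κ i) :
        MvPolynomial (Fin n × Fin n) ℤ) ≤ 4 * (m + 1) ^ 4 + m * m * (5 * m + 2) + 1 :=
      (constantFreeComplexity_C_neg_one_pow_mul_le k _).trans
        (Nat.add_le_add_right (constantFreeComplexity_C_adjugate_vandermonde_le m κ i) 1)
    have h2 : constantFreeComplexity
        (aeval (fun o : Option (Fin n × Fin n) => o.elim (C ((i : ℤ) - 1)) X) F) ≤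
          n ^ a + a + (3 * m + 1) := by
      refine (constantFreeComplexity_aeval_elim_le F _).trans (Nat.add_le_add (hF n) ?_)
      refine (constantFreeComplexity_C_intCast_le_log _).trans ?_
      have habs : (((i : ℕ) : ℤ) - 1).natAbs ≤ (i : ℕ) + 1 := by omega
      have hlog : Nat.log 2 ((((i : ℕ) : ℤ) - 1).natAbs) ≤ m :=
        (Nat.log_le_self 2 _).trans (habs.trans (Nat.succ_le_of_lt i.isLt))
      omega
    -- everything in powers of `X = n + 2`
    have hXa1 : n ^ a ≤ (n + 2) ^ a := Nat.pow_le_pow_left (by omega) _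
    have hXa2 : a ≤ (n + 2) ^ a := le_trans (Nat.lt_two_pow_self).le (Nat.pow_le_pow_left hX2 _)
    have hm1 : (m + 1) ^ 4 ≤ (n + 2) ^ 8 := by
      calc (m + 1) ^ 4 ≤ ((n + 2) ^ 2) ^ 4 := Nat.pow_le_pow_left hmX 4
        _ = (n + 2) ^ 8 := by rw [← pow_mul]
    have hm2 : m * m ≤ (n + 2) ^ 4 := by
      calc m * m ≤ (n + 2) ^ 2 * (n + 2) ^ 2 := Nat.mul_le_mul (by omega) (by omega)
        _ = (n + 2) ^ 4 := by rw [← pow_add]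
    have hm3 : 5 * m + 2 ≤ 6 * (n + 2) ^ 2 := by nlinarith
    have hm4 : m * m * (5 * m + 2) ≤ 6 * (n + 2) ^ 8 := by
      calc m * m * (5 * m + 2) ≤ (n + 2) ^ 4 * (6 * (n + 2) ^ 2) := Nat.mul_le_mul hm2 hm3
        _ = 6 * ((n + 2) ^ 4 * (n + 2) ^ 2) := by ring
        _ ≤ 6 * ((n + 2) ^ 4 * (n + 2) ^ 4) :=
            Nat.mul_le_mul_left _ (Nat.mul_le_mul_left _ (Nat.pow_le_pow_right (by omega) (by omega)))
        _ = 6 * (n + 2) ^ 8 := by rw [← pow_add]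
    have hm5 : 3 * m + 1 ≤ 4 * (n + 2) ^ 8 := by
      have : (n + 2) ^ 2 ≤ (n + 2) ^ 8 := Nat.pow_le_pow_right (by omega) (by omega)
      omega
    have hp1 : (n + 2) ^ a ≤ (n + 2) ^ (a + 8) := Nat.pow_le_pow_right (by omega) (by omega)
    have hp2 : (n + 2) ^ 8 ≤ (n + 2) ^ (a + 8) := Nat.pow_le_pow_right (by omega) (by omega)
    omega
  -- sum of the `m` terms
  refine (constantFreeComplexity_finset_sum_le _ _).trans ?_
  rw [Finset.card_univ, Fintype.card_fin]
  have hsum : ∑ i : Fin m, constantFreeComplexity (C ((-1) ^ k * V.adjugate κ i) *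
      aeval (fun o : Option (Fin n × Fin n) => o.elim (C ((i : ℤ) - 1)) X) F) ≤
        m * (18 * (n + 2) ^ (a + 8) + 1) := by
    refine (Finset.sum_le_sum fun i _ => hterm i).trans ?_
    rw [Finset.sum_const, Finset.card_univ, Fintype.card_fin, smul_eq_mul]
  have hm0 : m ≤ (n + 2) ^ 2 := by omega
  have hfin : m * (18 * (n + 2) ^ (a + 8) + 1) + m ≤ 20 * (n + 2) ^ (a + 10) := by
    have e : (n + 2) ^ (a + 10) = (n + 2) ^ 2 * (n + 2) ^ (a + 8) := by rw [← pow_add]; ring_nf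
    have h1 : 1 ≤ (n + 2) ^ (a + 8) := Nat.one_le_pow _ _ (by omega)
    rw [e]
    nlinarith
  have h20 : 20 * (n + 2) ^ (a + 10) ≤ (n + 2) ^ (a + 15) := by
    have h5 : 20 ≤ (n + 2) ^ 5 := le_trans (by norm_num) (Nat.pow_le_pow_left hX2 5)
    calc 20 * (n + 2) ^ (a + 10) ≤ (n + 2) ^ 5 * (n + 2) ^ (a + 10) := Nat.mul_le_mul_right _ h5
      _ = (n + 2) ^ (a + 15) := by rw [← pow_add]; ring_nf
  omega


/-! ### The 2-adic depth of the multiplier -/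

/-- `det V ≤ m^{m·m}` for the integer Vandermonde matrix on `0, …, m-1` (each of the `≤ m²`
factors `j - i` of `det V = ∏_{i<j} (j - i)` is at most `m`). [folklore] -/
theorem det_vandermonde_nat_le (m : ℕ) :
    (Matrix.vandermonde (fun i : Fin m => (i : ℤ))).det ≤ (m : ℤ) ^ (m * m) := by
  rw [Matrix.det_vandermonde]
  have hfac : ∀ i j : Fin m, j ∈ Ioi i → (0 : ℤ) ≤ (j : ℤ) - (i : ℤ) ∧ ((j : ℤ) - (i : ℤ)) ≤ (m : ℤ) := by
    intro i j hj
    rw [Finset.mem_Ioi] at hj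
    have h1 : (i : ℕ) < (j : ℕ) := hj
    have h2 : (j : ℕ) < m := j.isLt
    constructor <;> omega
  have hinner : ∀ i : Fin m, (0 : ℤ) ≤ ∏ j ∈ Ioi i, ((j : ℤ) - (i : ℤ)) ∧
      ∏ j ∈ Ioi i, ((j : ℤ) - (i : ℤ)) ≤ (m : ℤ) ^ m := by
    intro i
    refine ⟨Finset.prod_nonneg fun j hj => (hfac i j hj).1, ?_⟩
    calc ∏ j ∈ Ioi i, ((j : ℤ) - (i : ℤ)) ≤ ∏ _j ∈ Ioi i, (m : ℤ) :=
          Finset.prod_le_prod (fun j hj => (hfac i j hj).1) fun j hj => (hfac i j hj).2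
      _ = (m : ℤ) ^ (Ioi i).card := Finset.prod_const _
      _ ≤ (m : ℤ) ^ m := by
          have hm1 : (1 : ℤ) ≤ m := by exact_mod_cast (show 1 ≤ m from by have := i.isLt; omega)
          exact pow_le_pow_right₀ hm1 ((Finset.card_le_univ _).trans (by simp))
  calc ∏ i : Fin m, ∏ j ∈ Ioi i, ((j : ℤ) - (i : ℤ)) ≤ ∏ _i : Fin m, (m : ℤ) ^ m :=
        Finset.prod_le_prod (fun i _ => (hinner i).1) fun i _ => (hinner i).2
    _ = ((m : ℤ) ^ m) ^ m := by rw [Finset.prod_const, Finset.card_univ, Fintype.card_fin]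
    _ = (m : ℤ) ^ (m * m) := by rw [← pow_mul]

/-- **The Vandermonde multiplier has polynomial 2-adic depth**:
`v₂(det V · 2^p) ≤ m·m·(log₂ m + 1) + p`. [folklore] -/
theorem padicValNat_two_vandermondeMultiplier_le (m p : ℕ) (hm : 1 ≤ m) :
    padicValNat 2 ((Matrix.vandermonde (fun i : Fin m => (i : ℤ))).det.toNat * 2 ^ p) ≤
      m * m * (Nat.log 2 m + 1) + p := by
  set D := (Matrix.vandermonde (fun i : Fin m => (i : ℤ))).det with hD
  have hDpos : 0 < D := det_vandermonde_nat_pos m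
  have hD0 : D.toNat ≠ 0 := by omega
  rw [padicValNat.mul hD0 (pow_ne_zero _ two_ne_zero), padicValNat.prime_pow]
  refine Nat.add_le_add_right ?_ p
  -- `v₂(D) ≤ log₂ D ≤ log₂ (m^{m m}) < (log₂ m + 1) m m`
  have hle : D.toNat ≤ m ^ (m * m) := by
    rw [Int.toNat_le]
    push_cast
    exact det_vandermonde_nat_le m
  refine (padicValNat_le_nat_log _).trans ((Nat.log_mono_right hle).trans ?_)
  have hlt : m ^ (m * m) < (2 ^ (Nat.log 2 m + 1)) ^ (m * m) :=
    Nat.pow_lt_pow_left (Nat.lt_pow_succ_log_self one_lt_two m)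
      (Nat.pos_iff_ne_zero.mp (Nat.mul_pos hm hm))
  rw [← pow_mul] at hlt
  have := Nat.log_lt_of_lt_pow (pow_ne_zero _ (by omega)) hlt
  calc Nat.log 2 (m ^ (m * m)) ≤ (Nat.log 2 m + 1) * (m * m) := this.le
    _ = m * m * (Nat.log 2 m + 1) := by ring

/-! ### Cheap multiples of polynomial 2-adic depth, and the falsifier of `CF^ult` -/

/-- **Cheap multiples of polynomial 2-adic depth from cheap `2^p`-multiples of the pencil**: if
`τ(2^{p(n)} P_n) ≤ n^a + a` and `p(n) ≤ n^{a'} + a'`, then every jet has a multiple `M·J_(n,k)`,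
`M ≥ 1`, with `v₂(M) ≤ (n+2)^{a+a'+23}` and `τ(M·J_(n,k)) ≤ (n+2)^{a+a'+23}`. [folklore] -/
theorem cheapJetMultiplesTwoAdic_of_twoPowPencilCheap (p : ℕ → ℕ) (a a' : ℕ)
    (hF : ∀ n : ℕ, constantFreeComplexity (C ((2 : ℤ) ^ p n) * ∑ σ : Equiv.Perm (Fin n),
        (X none : MvPolynomial (Option (Fin n × Fin n)) ℤ) ^
            (univ.filter (fun q : Fin n × Fin n => q.1 < q.2 ∧ σ q.2 < σ q.1)).card *
          ∏ i : Fin n, X (some (σ i, i))) ≤ n ^ a + a)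
    (hp : ∀ n : ℕ, p n ≤ n ^ a' + a') :
    ∃ c : ℕ, ∀ n k : ℕ, ∃ M : ℕ, 1 ≤ M ∧ padicValNat 2 M ≤ (n + 2) ^ c ∧
      constantFreeComplexity ((M : ℤ) • jet n k) ≤ (n + 2) ^ c := by
  refine ⟨a + a' + 23, fun n k => ?_⟩
  have hX2 : 2 ≤ n + 2 := by omega
  by_cases hk : k < n * (n - 1) / 2 + 1
  swap
  · -- beyond the degree the jet vanishes: `M = 1`
    refine ⟨1, le_rfl, by simp, ?_⟩
    have hdeg := natDegree_shiftedPencil_le ℤ n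
    have hjet : jet n k = (-1 : ℤ) ^ k • (optionEquivLeft ℤ (Fin n × Fin n) (∑ σ : Equiv.Perm (Fin n),
        ((X none : MvPolynomial (Option (Fin n × Fin n)) ℤ) - 1) ^
            (univ.filter (fun q : Fin n × Fin n => q.1 < q.2 ∧ σ q.2 < σ q.1)).card *
          ∏ i : Fin n, X (some (σ i, i)))).coeff k := by
      have h := map_jet_eq_smul_coeff ℤ n k
      rw [Int.castRingHom_int, MvPolynomial.map_id] at h
      exact h
    rw [hjet, Polynomial.coeff_eq_zero_of_natDegree_lt (by omega), smul_zero, smul_zero,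
      constantFreeComplexity_zero]
    exact Nat.zero_le _
  -- the explicit multiplier `det V · 2^{p n}`
  have hexp := cheapJetMultiple_explicit p a hF n k hk
  have hDpos := det_vandermonde_nat_pos (n * (n - 1) / 2 + 1)
  have hv := padicValNat_two_vandermondeMultiplier_le (n * (n - 1) / 2 + 1) (p n) (by omega)
  refine ⟨(Matrix.vandermonde (fun i : Fin (n * (n - 1) / 2 + 1) => (i : ℤ))).det.toNat * 2 ^ p n,
    ?_, hv.trans ?_, hexp.trans (Nat.pow_le_pow_right (by omega) (by omega))⟩
  · have : 0 < (Matrix.vandermonde (fun i : Fin (n * (n - 1) / 2 + 1) => (i : ℤ))).det.toNat := by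
      omega
    exact Nat.mul_pos this (pow_pos (by norm_num) _)
  · -- the 2-adic depth is polynomial
    have hmX : n * (n - 1) / 2 + 1 + 1 ≤ (n + 2) ^ 2 := nodes_le_sq n
    have hlog : Nat.log 2 (n * (n - 1) / 2 + 1) + 1 ≤ (n + 2) ^ 2 :=
      (Nat.succ_le_succ (Nat.log_le_self 2 _)).trans hmX
    have hm2 : (n * (n - 1) / 2 + 1) * (n * (n - 1) / 2 + 1) ≤ (n + 2) ^ 4 := by
      calc (n * (n - 1) / 2 + 1) * (n * (n - 1) / 2 + 1) ≤ (n + 2) ^ 2 * (n + 2) ^ 2 :=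
            Nat.mul_le_mul (by omega) (by omega)
        _ = (n + 2) ^ 4 := by rw [← pow_add]
    have h1 : (n * (n - 1) / 2 + 1) * (n * (n - 1) / 2 + 1) * (Nat.log 2 (n * (n - 1) / 2 + 1) + 1) ≤
        (n + 2) ^ 6 := by
      calc (n * (n - 1) / 2 + 1) * (n * (n - 1) / 2 + 1) * (Nat.log 2 (n * (n - 1) / 2 + 1) + 1)
          ≤ (n + 2) ^ 4 * (n + 2) ^ 2 := Nat.mul_le_mul hm2 hlog
        _ = (n + 2) ^ 6 := by rw [← pow_add]
    have hXa1 : n ^ a' ≤ (n + 2) ^ a' := Nat.pow_le_pow_left (by omega) _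
    have hXa2 : a' ≤ (n + 2) ^ a' := le_trans (Nat.lt_two_pow_self).le (Nat.pow_le_pow_left hX2 _)
    have hp1 : (n + 2) ^ 6 ≤ (n + 2) ^ (a + a' + 21) := Nat.pow_le_pow_right (by omega) (by omega)
    have hp2 : (n + 2) ^ a' ≤ (n + 2) ^ (a + a' + 21) := Nat.pow_le_pow_right (by omega) (by omega)
    have hp3 : 3 * (n + 2) ^ (a + a' + 21) ≤ (n + 2) ^ (a + a' + 23) := by
      have h4 : 3 ≤ (n + 2) ^ 2 := by nlinarith
      calc 3 * (n + 2) ^ (a + a' + 21) ≤ (n + 2) ^ 2 * (n + 2) ^ (a + a' + 21) :=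
            Nat.mul_le_mul_right _ h4
        _ = (n + 2) ^ (a + a' + 23) := by rw [← pow_add]; ring_nf
    have := hp n
    omega

/-- **If the permanent is constant-free easy, every jet has a uniformly cheap multiple of
polynomial 2-adic depth** (Bürgisser Thm. 2.10 on the `VNP⁰` pencil, keeping the polynomial bound
on the exponent `p(n)`, then the explicit Vandermonde multiplier). [cite: Burgisser2009, Thm. 2.10] -/
theorem cheapJetMultiplesTwoAdic_of_perEasy
    (hper : IsPBounded fun n => constantFreeComplexity (perPoly (Fin n) ℤ)) :
    ∃ c : ℕ, ∀ n k : ℕ, ∃ M : ℕ, 1 ≤ M ∧ padicValNat 2 M ≤ (n + 2) ^ c ∧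
      constantFreeComplexity ((M : ℤ) • jet n k) ≤ (n + 2) ^ c := by
  obtain ⟨p, ⟨a', ha'⟩, a, ha⟩ := Burgisser2009_thm210_holds hper (fun n => Option (Fin n × Fin n)) _
    isVNP0Family_pencil
  exact cheapJetMultiplesTwoAdic_of_twoPowPencilCheap p a a' ha ha'

/-- **The cheapest falsifier of the re-glued crux `CF^ult`**: `τ(PER_n) = n^{O(1)} ⟹ ¬CF^ult`
(at `c' = 2c + 1` the admissible multiple `det V · 2^{p(n)}` of the `CF^ult`-jet is too cheap).
[cite: Burgisser2009, Thm. 2.10] -/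
theorem not_cfUlt_of_perEasy
    (hper : IsPBounded fun n => constantFreeComplexity (perPoly (Fin n) ℤ)) :
    ¬ (∀ c : ℕ, ∃ k : ℕ, 1 ≤ k ∧ CFUltAt c k) := by
  intro hCF
  obtain ⟨c, hc⟩ := cheapJetMultiplesTwoAdic_of_perEasy hper
  obtain ⟨k, -, hk⟩ := hCF (2 * c + 1)
  obtain ⟨n, hn, hM⟩ := hk (max (2 ^ k) 2)
  have hn2 : 2 ≤ n := le_trans (le_max_right _ _) hn
  obtain ⟨M, hM1, hv, hτ⟩ := hc n k
  have hsq : (n + 2) ^ c ≤ n ^ (2 * c) := by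
    calc (n + 2) ^ c ≤ (n ^ 2) ^ c := Nat.pow_le_pow_left (by nlinarith) _
      _ = n ^ (2 * c) := by rw [← pow_mul]
  have hlt : n ^ (2 * c) < n ^ (2 * c + 1) := Nat.pow_lt_pow_right (by omega) (by omega)
  have h1 : n ^ (2 * c + 1) ≤ (n + 2) ^ c := hM M hM1 (by omega) |>.trans hτ
  omega

/-- **`CF^ult ⊢ τ(PER_n) ≠ n^{O(1)}`**: the re-glued constant-free crux carries (alone) Bürgisser's
hypothesis "the permanent is not constant-free easy". [cite: Burgisser2009, Thm. 2.10] -/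
theorem not_isPBounded_tau_per_of_cfUlt (hCF : ∀ c : ℕ, ∃ k : ℕ, 1 ≤ k ∧ CFUltAt c k) :
    ¬ IsPBounded fun n => constantFreeComplexity (perPoly (Fin n) ℤ) :=
  fun hper => not_cfUlt_of_perEasy hper hCF

end Summit.ValiantsHypothesis.ValiantsHypothesis.Theorems.AnyonJets.JetConstantElim

end
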